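import Mathlib.Combinatorics.SimpleGraph.Connectivity.Connected
import Mathlib.LinearAlgebra.Matrix.Kronecker
import Mathlib.Data.Matrix.Block
import HarnessLib

/-!
# Crux `Capture` (stmt-PneNP-2659) — the T-JOIN door is ONE GRANK gate: definitions

Objects of the positive one-gate theorem `pairConnected_isGRankGate`
(`ConvexRankGatesCaptureTJoinGate.lean`): for a fixed multigraph on a finite vertex type `V` with edge
list `(p i, q i)`, `i : Fin n` (the inputs), and terminals `τ : Fin k → V`, the monotone function

  `v ↦ [the terminals can be perfectly paired so that each pair is connected in the selected subgraph]`

(= existence of a `T`-join inside the selected edges = membership of `𝟙_T` in the `𝔽₂`-span of the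
selected edge vectors `e_u + e_w`: the GRAPHIC case of the abelian PERM / XOR-SAT door) is ONE generic-rank
gate. The symbolic matrix is a TRANSFER matrix: `k` identical layered copies of the lazy walk matrix
`1 + A(x)` (`layerMat = ((1 + adjW) ⊗ shift) ⊗ 1`, nilpotent part of `bigN`), sources entering copy `j`
at `(τ i, last layer)` with SKEW generic weights `c i j` (`srcMat`), sinks leaving copy `j` at
`(τ j, layer 0)` (`snkMat`); its Schur complement is the alternating PAIRING matrix
`schurM j i = c i j · ((1 + A)^L) (τ j) (τ i)` (`ConvexRankGatesCaptureTJoinDet.lean`), whose determinant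
vanishes iff some connectivity class holds an odd number of terminals. This file only fixes the
vocabulary; `adjW_transpose` is the registered anchor. [folklore]
-/

namespace Summit.PneNP.PneNP.Theorems.Capture.TJoin

set_option linter.dupNamespace false -- `Summit.PneNP.PneNP.…`: summit = sub-problem (D-0017)

open Matrix Finset
open scoped Kronecker

variable {V : Type} [DecidableEq V] {n k : ℕ} {R : Type*} [CommRing R]

/-- **Weighted adjacency matrix** of the edge list `(p i, q i)`, `i : Fin n`, with edge weights `w i`:
entry `(u, u')` is the total weight of the listed edges joining `u` and `u'` (both orientations).
[folklore] -/
def adjW (p q : Fin n → V) (w : Fin n → R) : Matrix V V R :=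
  Matrix.of fun u u' => ∑ i, if (p i = u ∧ q i = u') ∨ (p i = u' ∧ q i = u) then w i else 0

omit [DecidableEq V] in
/-- Entries of `adjW`. [folklore] -/
theorem adjW_apply [DecidableEq V] (p q : Fin n → V) (w : Fin n → R) (u u' : V) :
    adjW p q w u u' = ∑ i, if (p i = u ∧ q i = u') ∨ (p i = u' ∧ q i = u) then w i else 0 := rfl

/-- **`adjW` is symmetric** (registered anchor `adjW_transpose`). [folklore] -/
theorem adjW_transpose : ∀ {V : Type} [DecidableEq V] {n : ℕ} {R : Type} [CommRing R]
    (p q : Fin n → V) (w : Fin n → R), (adjW p q w)ᵀ = adjW p q w := by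
  intro V _ n R _ p q w
  ext u u'
  simp only [transpose_apply, adjW_apply]
  exact Finset.sum_congr rfl fun i _ => by
    simp only [or_comm (a := p i = u' ∧ q i = u)]

/-- **Layer shift** on `Fin (L+1)`: `shiftMat L a b = 1` iff `b = a + 1` (strictly upper triangular,
nilpotent of order `L + 1`). [folklore] -/
def shiftMat (L : ℕ) : Matrix (Fin (L + 1)) (Fin (L + 1)) R :=
  Matrix.of fun a b => if (b : ℕ) = a + 1 then 1 else 0

/-- Entries of `shiftMat`. [folklore] -/
theorem shiftMat_apply (L : ℕ) (a b : Fin (L + 1)) :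
    (shiftMat L : Matrix _ _ R) a b = if (b : ℕ) = a + 1 then 1 else 0 := rfl

/-- **The layered transfer matrix of `k` identical copies**: `((1 + adjW) ⊗ shift) ⊗ 1_k`, indexed by
`(vertex, layer, copy)`; one step moves along a lazy edge and up one layer inside the same copy.
[folklore] -/
def layerMat (p q : Fin n → V) (w : Fin n → R) (L k : ℕ) :
    Matrix ((V × Fin (L + 1)) × Fin k) ((V × Fin (L + 1)) × Fin k) R :=
  ((1 + adjW p q w) ⊗ₖ (shiftMat L : Matrix _ _ R)) ⊗ₖ (1 : Matrix (Fin k) (Fin k) R)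

/-- **Sources**: source `i` enters copy `j` at `(τ i, layer L)` with weight `c i j`. [folklore] -/
def srcMat (τ : Fin k → V) (c : Fin k → Fin k → R) (L : ℕ) :
    Matrix ((V × Fin (L + 1)) × Fin k) (Fin k) R :=
  Matrix.of fun r i => if r.1.1 = τ i ∧ (r.1.2 : ℕ) = L then c i r.2 else 0

/-- Entries of `srcMat`. [folklore] -/
theorem srcMat_apply (τ : Fin k → V) (c : Fin k → Fin k → R) (L : ℕ) (r : (V × Fin (L + 1)) × Fin k)
    (i : Fin k) : srcMat τ c L r i = if r.1.1 = τ i ∧ (r.1.2 : ℕ) = L then c i r.2 else 0 := rfl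

/-- **Sinks**: sink `j` reads copy `j` at `(τ j, layer 0)`. [folklore] -/
def snkMat (τ : Fin k → V) (L : ℕ) : Matrix (Fin k) ((V × Fin (L + 1)) × Fin k) R :=
  Matrix.of fun j r => if r = ((τ j, 0), j) then 1 else 0

/-- Entries of `snkMat`. [folklore] -/
theorem snkMat_apply (τ : Fin k → V) (L : ℕ) (j : Fin k) (r : (V × Fin (L + 1)) × Fin k) :
    (snkMat τ L : Matrix _ _ R) j r = if r = ((τ j, 0), j) then 1 else 0 := rfl

/-- **The transfer matrix** `[[1 − layerMat, srcMat], [snkMat, 0]]` — affine in the edge weights `w`,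
linear in the source weights `c`. [folklore] -/
def bigN (p q : Fin n → V) (τ : Fin k → V) (w : Fin n → R) (c : Fin k → Fin k → R) (L : ℕ) :
    Matrix (((V × Fin (L + 1)) × Fin k) ⊕ Fin k) (((V × Fin (L + 1)) × Fin k) ⊕ Fin k) R :=
  Matrix.fromBlocks (1 - layerMat p q w L k) (srcMat τ c L) (snkMat τ L) 0

/-- **The pairing matrix** (Schur complement of the transfer matrix):
`schurM j i = c i j · ((1 + adjW)^L) (τ j) (τ i)` — the `c`-weighted lazy-walk count of length `L`
between the terminals `τ j` and `τ i`. [folklore] -/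
def schurM [Fintype V] (p q : Fin n → V) (τ : Fin k → V) (w : Fin n → R) (c : Fin k → Fin k → R)
    (L : ℕ) : Matrix (Fin k) (Fin k) R :=
  Matrix.of fun j i => c i j * ((1 + adjW p q w) ^ L) (τ j) (τ i)

/-- Entries of `schurM`. [folklore] -/
theorem schurM_apply [Fintype V] (p q : Fin n → V) (τ : Fin k → V) (w : Fin n → R)
    (c : Fin k → Fin k → R) (L : ℕ) (j i : Fin k) :
    schurM p q τ w c L j i = c i j * ((1 + adjW p q w) ^ L) (τ j) (τ i) := rfl

end Summit.PneNP.PneNP.Theorems.Capture.TJoin
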